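import Mathlib
import HarnessLib.Audit
import Summits.PneNP.PneNP.Theorems.PstarFreeMonomialWitness
import Summits.PneNP.PneNP.Theorems.PstarCleanCut
import Summits.PneNP.PneNP.Theorems.PstarSliceGenericExact

/-!
# NO CLEAN BRIDGE: an outside-gated chord is never the only member crossing a vertex cut (ROUND-24, O1; all core sizes; memo g24 §39)

FRONTIER range-avoidance ladder, rung F-N3, ROUND 24 (cell `pnp-ideate`, prover-2 memo `g24/O1-NOFREEVERTEX-g24.md` §39; typed targets
`PstarCoreBoundTargets.TerminalFive` / `TerminalPeelable` (p646951); restricted-model proof complexity — nothing here bears on `P` versus `NP`).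

`PstarCleanCutAssembly.false_of_cleanCut_two` excludes clean cuts crossed TWICE (inside the core-bound induction).  This file excludes clean cuts
crossed ONCE, unconditionally: **`false_of_clean_bridge`** — in a terminal core `(K; Γ₁, Γ₂)` no outside-gated chord `e` is the unique member of
`K` crossing a vertex set `W`.

Proof (the SIDE FLIP).  Let `S` = the XOR vertices of `K` in `W` and `φ` = flip every variable of `S` (`xflip`).  Every member other than `e`
has both or no XOR endpoint in `S`, so `φ` preserves it; `e` has exactly one, so `φ` toggles it; the readers, linear in XOR variables, shift by
constants `ε₁, ε₂` (`exists_shift_gval_xflip`), and `(ε₁, ε₂) ≠ 0` (flip the (M0) witness of `e` into `Sol(K)`).  The TWISTED readers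
`Ψ_k = Γ_k ⊕ ε_k·(x_a ⊕ x_b ⊕ x_p x_q)` (`a, b, p, q` the variables of `e`) then satisfy: (T3') `K ∖ e ∧ Ψ = b'` is unsolvable
(`b'_k = b_k ⊕ ε_k y_e`; split by whether `e` holds, flipping by `φ` if not), while the (M0) witness of any other member is on target for `Ψ`.
On the fibre of that witness the monomial `e` of the restricted twisted readers is FREE (its variables `p, q` lie in no member of `K ∖ e` and, `e`
being outside-gated, in no other internal monomial) — contradicting `PstarFreeMonomialWitness.false_of_free_monomial_of_witness`.

Consequences: with `false_of_cleanCut_two`, inside the induction NO clean cut of a terminal core is crossed at all — every outside-gated chord has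
both endpoints in one skeleton component and the skeleton components are the XOR-components of the core; `noCrossing_of_terminal` packages the
unconditional half (`≠ 1` crossing).
-/

set_option linter.dupNamespace false -- `Summit.PneNP.PneNP.…`: summit = sub-problem name (D-0017 single-conjunct layout)

open Finset Literature.Computability.Complexity
open scoped symmDiff
open Summit.PneNP.PneNP.Theorems.PstarFibrePolys (bit bit_injective bit_xor bit_and)
open Summit.PneNP.PneNP.Theorems.PstarTyped (Typed)
open Summit.PneNP.PneNP.Theorems.PstarSALevel (varSet bdry BoundaryExpanding SimpleOverlap)
open Summit.PneNP.PneNP.Theorems.PstarXCore (xpair mem_xpair xverts)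
open Summit.PneNP.PneNP.Theorems.PstarCentreFree (vars_mem_varSet)
open Summit.PneNP.PneNP.Theorems.PstarGapPeeling (not_mem_varSet_of_private eval_pure)
open Summit.PneNP.PneNP.Theorems.PstarGapOneAll (gval)
open Summit.PneNP.PneNP.Theorems.PstarGConstraint (bit_gval)
open Summit.PneNP.PneNP.Theorems.PstarGSystemFreeVar (gval_symmDiff)
open Summit.PneNP.PneNP.Theorems.PstarCoreBound (XorClosed)
open Summit.PneNP.PneNP.Theorems.PstarChordRepair (IsChord)
open Summit.PneNP.PneNP.Theorems.PstarCoreBoundTargets (Terminal)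
open Summit.PneNP.PneNP.Theorems.PstarChordBridgeExchange (mem_xverts_iff)
open Summit.PneNP.PneNP.Theorems.PstarNorUnitCoverTools (two_le_xpdeg_of_xorClosed exists_ne_of_two_le_xpdeg)
open Summit.PneNP.PneNP.Theorems.PstarChordReadFlip (mv gval_flip)
open Summit.PneNP.PneNP.Theorems.PstarChordReadOutside (OutsideGated exists_gate_of_slot)
open Summit.PneNP.PneNP.Theorems.PstarChordReadRestrictVar (restrictL constL overrideL gval_restrictL restrictL_snd_subset)
open Summit.PneNP.PneNP.Theorems.PstarChordReadNor (fibreList mem_fibreList overrideL_fibreList_self solves_overrideL_fibreList)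
open Summit.PneNP.PneNP.Theorems.PstarChordReadFibre (outside mem_outside not_mem_outside_of_mem mv_of_no_monomial)
open Summit.PneNP.PneNP.Theorems.PstarSliceGenericInternal (internalMenu mem_internalMenu)
open Summit.PneNP.PneNP.Theorems.PstarSliceGenericExact (restrictL_fibre_snd)
open Summit.PneNP.PneNP.Theorems.PstarCleanCut (Crosses)
open Summit.PneNP.PneNP.Theorems.PstarFreeMonomialWitness (false_of_free_monomial_of_witness)

namespace Summit.PneNP.PneNP.Theorems.PstarCleanBridge

variable {n m : ℕ}

/-! ## Flipping a set of XOR variables -/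

/-- Flip every variable of `S`. -/
def xflip (S : Finset (Fin n)) (x : Fin n → Bool) : Fin n → Bool := fun v => if v ∈ S then !x v else x v

/-- `xflip` at a variable of `S`. -/
theorem xflip_of_mem {S : Finset (Fin n)} {x : Fin n → Bool} {v : Fin n} (h : v ∈ S) : xflip S x v = !x v := by
  unfold xflip; rw [if_pos h]

/-- `xflip` off `S`. -/
theorem xflip_of_not_mem {S : Finset (Fin n)} {x : Fin n → Bool} {v : Fin n} (h : v ∉ S) : xflip S x v = x v := by
  unfold xflip; rw [if_neg h]

/-- Inserting a variable: one more single flip. -/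
theorem xflip_insert {S : Finset (Fin n)} {v : Fin n} (hv : v ∉ S) (x : Fin n → Bool) :
    xflip (insert v S) x = Function.update (xflip S x) v (!xflip S x v) := by
  funext u
  by_cases huv : u = v
  · subst huv
    rw [Function.update_self, xflip_of_mem (mem_insert_self u S), xflip_of_not_mem hv]
  · rw [Function.update_of_ne huv]
    by_cases hu : u ∈ S
    · rw [xflip_of_mem (mem_insert_of_mem hu), xflip_of_mem hu]
    · rw [xflip_of_not_mem hu, xflip_of_not_mem fun h => (mem_insert.1 h).elim huv hu]

variable (I : LocalMap 4 n m)

/-- **A reader none of whose monomials meets `S` shifts by a constant under `xflip S`.** -/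
theorem exists_shift_gval_xflip (hI : I.IsPure xorAndPred) (C : Finset (Fin n)) (G : Finset (Fin m)) :
    ∀ S : Finset (Fin n), (∀ v ∈ S, ∀ g ∈ G, I.vars g 2 ≠ v ∧ I.vars g 3 ≠ v) →
      ∃ ε : Bool, ∀ x : Fin n → Bool, gval I C G (xflip S x) = xor (gval I C G x) ε := by
  classical
  intro S
  induction S using Finset.induction_on with
  | empty =>
    intro _
    refine ⟨false, fun x => ?_⟩
    have : xflip (∅ : Finset (Fin n)) x = x := funext fun v => xflip_of_not_mem (notMem_empty v)
    rw [this, Bool.xor_false]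
  | insert v S hv ih =>
    intro hS
    obtain ⟨ε, hε⟩ := ih fun u hu => hS u (mem_insert_of_mem hu)
    refine ⟨xor ε (decide (v ∈ C)), fun x => ?_⟩
    rw [xflip_insert hv, gval_flip I C G hI, mv_of_no_monomial I C G (hS v (mem_insert_self v S)), hε]
    cases gval I C G x <;> cases ε <;> cases decide (v ∈ C) <;> rfl

/-- **An output with both or no XOR endpoint in `S` (and AND variables off `S`) is preserved by `xflip S`.** -/
theorem eval_xflip_of_iff (hI : I.IsPure xorAndPred) {S : Finset (Fin n)} {j : Fin m} (h2 : I.vars j 2 ∉ S) (h3 : I.vars j 3 ∉ S)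
    (hiff : I.vars j 0 ∈ S ↔ I.vars j 1 ∈ S) (x : Fin n → Bool) : I.eval (xflip S x) j = I.eval x j := by
  rw [eval_pure I hI, eval_pure I hI, xflip_of_not_mem h2, xflip_of_not_mem h3]
  by_cases h0 : I.vars j 0 ∈ S
  · rw [xflip_of_mem h0, xflip_of_mem (hiff.1 h0)]
    cases x (I.vars j 0) <;> cases x (I.vars j 1) <;> rfl
  · rw [xflip_of_not_mem h0, xflip_of_not_mem fun h1 => h0 (hiff.2 h1)]

/-- **An output with exactly one XOR endpoint in `S` is toggled by `xflip S`.** -/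
theorem eval_xflip_of_crosses (hI : I.IsPure xorAndPred) {S : Finset (Fin n)} {j : Fin m} (h2 : I.vars j 2 ∉ S) (h3 : I.vars j 3 ∉ S)
    (hc : Crosses I S j) (x : Fin n → Bool) : I.eval (xflip S x) j = !I.eval x j := by
  rw [eval_pure I hI, eval_pure I hI, xflip_of_not_mem h2, xflip_of_not_mem h3]
  rcases hc with ⟨h0, h1⟩ | ⟨h0, h1⟩
  · rw [xflip_of_mem h0, xflip_of_not_mem h1]
    cases x (I.vars j 0) <;> cases x (I.vars j 1) <;> cases (x (I.vars j 2) && x (I.vars j 3)) <;> rfl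
  · rw [xflip_of_not_mem h0, xflip_of_mem h1]
    cases x (I.vars j 0) <;> cases x (I.vars j 1) <;> cases (x (I.vars j 2) && x (I.vars j 3)) <;> rfl

/-- `gval {a, b} {e} x = x_a ⊕ x_b ⊕ x_p x_q`. -/
theorem gval_pair_single {a b : Fin n} (hab : a ≠ b) (e : Fin m) (x : Fin n → Bool) :
    gval I {a, b} {e} x = xor (xor (x a) (x b)) (x (I.vars e 2) && x (I.vars e 3)) := by
  apply bit_injective
  rw [bit_gval, sum_pair hab, sum_singleton, bit_xor, bit_xor, bit_and]

variable {I}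

/-! ## The theorem -/
section Main

variable {r : ℕ} {y : Fin m → Bool} {K : Finset (Fin m)} {w₁ w₂ : Finset (Fin n) × Finset (Fin m) × Bool} {e : Fin m}

/-- **NO CLEAN BRIDGE.**  In a terminal core `(K; w₁, w₂)` of a pure typed `(r,3/2)`-expanding instance with simple overlaps, an outside-gated
chord `e` is never the unique member of `K` crossing a vertex set `W`. -/
theorem false_of_clean_bridge (hI : I.IsPure xorAndPred) (hT : Typed I) (hS : SimpleOverlap I) (hB : BoundaryExpanding r I)
    (ht : Terminal I r y K w₁ w₂) (he : e ∈ K) (hch : IsChord I K e) (hO : OutsideGated I K (w₁.2.1 ∪ w₂.2.1) e) {W : Finset (Fin n)}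
    (hcross : Crosses I W e) (huniq : ∀ f ∈ K, f ≠ e → ¬ Crosses I W f) : False := by
  classical
  obtain ⟨-, hX, hKr, hd₁, hd₂, -, hT3, hM0⟩ := ht
  have T := fun (z : Fin n → Bool) (hz : ∀ j ∈ K, I.eval z j = y j) (h₁ : gval I w₁.1 w₁.2.1 z = w₁.2.2)
    (h₂ : gval I w₂.1 w₂.2.1 z = w₂.2.2) => hT3 ⟨z, hz, h₁, h₂⟩
  have h01 : I.vars e 0 ≠ I.vars e 1 := fun h => absurd (hI.2 e h) (by decide)
  -- the XOR vertices of `K` inside `W`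
  set S := (xverts I K).filter (· ∈ W) with hSdef
  have hSx : ∀ v ∈ S, ∃ j ∈ K, v ∈ xpair I j := fun v hv => (mem_xverts_iff I K v).1 (mem_filter.1 hv).1
  have hSand : ∀ v ∈ S, ∀ g : Fin m, I.vars g 2 ≠ v ∧ I.vars g 3 ≠ v := by
    intro v hv g
    obtain ⟨j, -, hvj⟩ := hSx v hv
    rcases (mem_xpair I).1 hvj with h | h
    · exact ⟨fun e' => hT j g 0 2 (by decide) (by decide) (h ▸ e'.symm), fun e' => hT j g 0 3 (by decide) (by decide) (h ▸ e'.symm)⟩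
    · exact ⟨fun e' => hT j g 1 2 (by decide) (by decide) (h ▸ e'.symm), fun e' => hT j g 1 3 (by decide) (by decide) (h ▸ e'.symm)⟩
  have hAnd : ∀ g : Fin m, I.vars g 2 ∉ S ∧ I.vars g 3 ∉ S :=
    fun g => ⟨fun h => (hSand _ h g).1 rfl, fun h => (hSand _ h g).2 rfl⟩
  have hSW : ∀ f ∈ K, ∀ s : Fin 4, s.val < 2 → (I.vars f s ∈ S ↔ I.vars f s ∈ W) := by
    intro f hf s hs
    rw [hSdef, mem_filter]
    exact ⟨fun h => h.2, fun h => ⟨(mem_xverts_iff I K _).2 ⟨f, hf, PstarNoFreeVertex.vars_mem_xpair f hs⟩, h⟩⟩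
  -- members other than `e` are preserved by the side flip, `e` is toggled
  have keep : ∀ f ∈ K, f ≠ e → ∀ x, I.eval (xflip S x) f = I.eval x f := by
    intro f hf hfe x
    refine eval_xflip_of_iff I hI (hAnd f).1 (hAnd f).2 ?_ x
    rw [hSW f hf 0 (by decide), hSW f hf 1 (by decide)]
    have hnc := huniq f hf hfe
    unfold PstarCleanCut.Crosses at hnc
    push Not at hnc
    constructor
    · exact fun h0 => hnc.1 h0
    · intro h1; by_contra h0; exact hnc.2 h0 h1
  have hcS : Crosses I S e := by
    unfold PstarCleanCut.Crosses at hcross ⊢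
    rw [hSW e he 0 (by decide), hSW e he 1 (by decide)]
    exact hcross
  have toggle : ∀ x, I.eval (xflip S x) e = !I.eval x e := fun x => eval_xflip_of_crosses I hI (hAnd e).1 (hAnd e).2 hcS x
  have solK : ∀ z, (∀ j ∈ K.erase e, I.eval z j = y j) → I.eval z e ≠ y e → ∀ j ∈ K, I.eval (xflip S z) j = y j := by
    intro z hz hze j hj
    by_cases hje : j = e
    · subst hje
      rw [toggle]
      revert hze; cases I.eval z j <;> cases y j <;> decide
    · rw [keep j hj hje]; exact hz j (mem_erase.2 ⟨hje, hj⟩)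
  -- the constant shifts of the two readers
  obtain ⟨ε₁, hε₁⟩ := exists_shift_gval_xflip I hI w₁.1 w₁.2.1 S fun v hv g _ => hSand v hv g
  obtain ⟨ε₂, hε₂⟩ := exists_shift_gval_xflip I hI w₂.1 w₂.2.1 S fun v hv g _ => hSand v hv g
  -- `(ε₁, ε₂) ≠ 0`: flip the witness of `e` into `Sol(K)`
  obtain ⟨wₑ, hwₑ, hwₑ₁, hwₑ₂⟩ := hM0 e he
  have hwₑe : I.eval wₑ e ≠ y e := by
    intro h
    refine T wₑ (fun j hj => ?_) hwₑ₁ hwₑ₂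
    by_cases hje : j = e
    · rw [hje]; exact h
    · exact hwₑ j (mem_erase.2 ⟨hje, hj⟩)
  have hε : (ε₁ || ε₂) = true := by
    by_contra h0
    have h1 : ε₁ = false := by revert h0; cases ε₁ <;> simp
    have h2 : ε₂ = false := by revert h0; cases ε₁ <;> cases ε₂ <;> simp
    refine T (xflip S wₑ) (solK wₑ hwₑ hwₑe) ?_ ?_
    · rw [hε₁, hwₑ₁, h1, Bool.xor_false]
    · rw [hε₂, hwₑ₂, h2, Bool.xor_false]
  -- the twisted readers
  set a := I.vars e 0 with ha
  set b := I.vars e 1 with hb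
  set p := I.vars e 2 with hp
  set q := I.vars e 3 with hq
  set τ : (Fin n → Bool) → Bool := fun x => xor (xor (x a) (x b)) (x p && x q) with hτ
  set Ψ₁ : Finset (Fin n) × Finset (Fin m) × Bool :=
    (w₁.1 ∆ (if ε₁ then ({a, b} : Finset (Fin n)) else ∅), w₁.2.1 ∆ (if ε₁ then ({e} : Finset (Fin m)) else ∅), xor w₁.2.2 (ε₁ && y e)) with hΨ₁
  set Ψ₂ : Finset (Fin n) × Finset (Fin m) × Bool :=
    (w₂.1 ∆ (if ε₂ then ({a, b} : Finset (Fin n)) else ∅), w₂.2.1 ∆ (if ε₂ then ({e} : Finset (Fin m)) else ∅), xor w₂.2.2 (ε₂ && y e)) with hΨ₂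
  have e0 : ∀ x : Fin n → Bool, gval I (∅ : Finset (Fin n)) (∅ : Finset (Fin m)) x = false := fun x => by
    apply bit_injective; rw [bit_gval]; simp [PstarFibrePolys.bit]
  have twist : ∀ (ε : Bool) (C : Finset (Fin n)) (G : Finset (Fin m)) (x : Fin n → Bool),
      gval I (C ∆ (if ε then ({a, b} : Finset (Fin n)) else ∅)) (G ∆ (if ε then ({e} : Finset (Fin m)) else ∅)) x =
        xor (gval I C G x) (ε && τ x) := by
    intro ε C G x
    rw [gval_symmDiff]
    cases ε
    · rw [if_neg Bool.false_ne_true, if_neg Bool.false_ne_true, e0, Bool.false_and]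
    · rw [if_pos rfl, if_pos rfl, gval_pair_single I h01 e x, Bool.true_and]
  have gΨ₁ : ∀ x, gval I Ψ₁.1 Ψ₁.2.1 x = xor (gval I w₁.1 w₁.2.1 x) (ε₁ && τ x) := fun x => twist ε₁ _ _ x
  have gΨ₂ : ∀ x, gval I Ψ₂.1 Ψ₂.2.1 x = xor (gval I w₂.1 w₂.2.1 x) (ε₂ && τ x) := fun x => twist ε₂ _ _ x
  -- `e` holds at `x` iff `τ x = y e`
  have τ_eq : ∀ x, I.eval x e = τ x := fun x => by rw [eval_pure I hI]
  -- (T3'): `K ∖ e ∧ Ψ = b'` is unsolvable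
  have T3' : ¬ ∃ z : Fin n → Bool, (∀ j ∈ K.erase e, I.eval z j = y j) ∧ gval I Ψ₁.1 Ψ₁.2.1 z = Ψ₁.2.2 ∧ gval I Ψ₂.1 Ψ₂.2.1 z = Ψ₂.2.2 := by
    rintro ⟨z, hz, hz₁, hz₂⟩
    rw [gΨ₁] at hz₁
    rw [gΨ₂] at hz₂
    change xor (gval I w₁.1 w₁.2.1 z) (ε₁ && τ z) = xor w₁.2.2 (ε₁ && y e) at hz₁
    change xor (gval I w₂.1 w₂.2.1 z) (ε₂ && τ z) = xor w₂.2.2 (ε₂ && y e) at hz₂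
    by_cases hze : I.eval z e = y e
    · -- `z` solves `K`: untwist
      rw [τ_eq] at hze
      refine T z (fun j hj => ?_) ?_ ?_
      · by_cases hje : j = e
        · rw [hje, τ_eq]; exact hze
        · exact hz j (mem_erase.2 ⟨hje, hj⟩)
      · rw [hze] at hz₁; revert hz₁; cases gval I w₁.1 w₁.2.1 z <;> cases w₁.2.2 <;> cases ε₁ <;> cases y e <;> decide
      · rw [hze] at hz₂; revert hz₂; cases gval I w₂.1 w₂.2.1 z <;> cases w₂.2.2 <;> cases ε₂ <;> cases y e <;> decide
    · -- `z` violates `e`: flip the side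
      have hze' : τ z = !y e := by rw [τ_eq] at hze; revert hze; cases τ z <;> cases y e <;> decide
      refine T (xflip S z) (solK z hz hze) ?_ ?_
      · rw [hε₁]; rw [hze'] at hz₁; revert hz₁; cases gval I w₁.1 w₁.2.1 z <;> cases w₁.2.2 <;> cases ε₁ <;> cases y e <;> decide
      · rw [hε₂]; rw [hze'] at hz₂; revert hz₂; cases gval I w₂.1 w₂.2.1 z <;> cases w₂.2.2 <;> cases ε₂ <;> cases y e <;> decide
  -- a second member `f ≠ e` and its witness, on target for `Ψ`
  have hax : a ∈ xverts I K := (mem_xverts_iff I K a).2 ⟨e, he, (mem_xpair I).2 (Or.inl rfl)⟩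
  obtain ⟨f, hf, hfe, -⟩ := exists_ne_of_two_le_xpdeg I hI e (two_le_xpdeg_of_xorClosed I hT hX a hax)
  obtain ⟨w, hw, hw₁, hw₂⟩ := hM0 f hf
  have hwe : τ w = y e := by rw [← τ_eq]; exact hw e (mem_erase.2 ⟨hfe.symm, he⟩)
  have hwΨ₁ : gval I Ψ₁.1 Ψ₁.2.1 w = Ψ₁.2.2 := by
    rw [gΨ₁, hw₁, hwe]
  have hwΨ₂ : gval I Ψ₂.1 Ψ₂.2.1 w = Ψ₂.2.2 := by
    rw [gΨ₂, hw₂, hwe]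
  -- restrict to the fibre of `w` (outside variables of `K`)
  set Z := outside I K with hZ
  set L := fibreList Z w with hL
  have hZout : ∀ z ∈ Z, ∀ j ∈ K.erase e, z ∉ varSet I j := fun z hz j hj => (mem_outside I).1 hz j (mem_of_mem_erase hj)
  set R₁ : Finset (Fin n) × Finset (Fin m) × Bool :=
    ((restrictL I Ψ₁.1 Ψ₁.2.1 L).1, (restrictL I Ψ₁.1 Ψ₁.2.1 L).2, xor Ψ₁.2.2 (constL I Ψ₁.1 Ψ₁.2.1 L)) with hR₁
  set R₂ : Finset (Fin n) × Finset (Fin m) × Bool :=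
    ((restrictL I Ψ₂.1 Ψ₂.2.1 L).1, (restrictL I Ψ₂.1 Ψ₂.2.1 L).2, xor Ψ₂.2.2 (constL I Ψ₂.1 Ψ₂.2.1 L)) with hR₂
  have hR₁G : R₁.2.1 = internalMenu I K Ψ₁.2.1 := restrictL_fibre_snd Ψ₁.1 Ψ₁.2.1 w
  have hR₂G : R₂.2.1 = internalMenu I K Ψ₂.2.1 := restrictL_fibre_snd Ψ₂.1 Ψ₂.2.1 w
  -- the monomials of the twisted readers
  have memΨ : ∀ (ε : Bool) (G : Finset (Fin m)) (g : Fin m), g ∈ G ∆ (if ε then ({e} : Finset (Fin m)) else ∅) → g = e ∨ g ∈ G := by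
    intro ε G g hg
    rw [mem_symmDiff] at hg
    rcases hg with ⟨h, -⟩ | ⟨h, -⟩
    · exact Or.inr h
    · cases ε
      · simp at h
      · simp at h; exact Or.inl h
  have hKΨ : ∀ (ε : Bool) (G : Finset (Fin m)), Disjoint K G → Disjoint (K.erase e) (internalMenu I K (G ∆ (if ε then ({e} : Finset (Fin m)) else ∅))) := by
    intro ε G hG
    refine disjoint_left.2 fun j hj hj' => ?_
    rcases memΨ ε G j ((mem_internalMenu I).1 hj').1 with h | h
    · exact (mem_erase.1 hj).1 h
    · exact disjoint_left.1 hG (mem_of_mem_erase hj) h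
  -- `e` is a free monomial of the restricted twisted readers
  have hpZ : p ∉ Z := not_mem_outside_of_mem I he (vars_mem_varSet I e 2)
  have hqZ : q ∉ Z := not_mem_outside_of_mem I he (vars_mem_varSet I e 3)
  have heΨ : ∀ (ε : Bool) (G : Finset (Fin m)), Disjoint K G → ε = true → e ∈ internalMenu I K (G ∆ (if ε then ({e} : Finset (Fin m)) else ∅)) := by
    intro ε G hG hε'
    subst hε'
    rw [mem_internalMenu]
    refine ⟨?_, hpZ, hqZ⟩
    rw [mem_symmDiff, if_pos rfl]
    exact Or.inr ⟨mem_singleton_self e, disjoint_left.1 hG he⟩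
  have hg : e ∈ R₁.2.1 ∪ R₂.2.1 := by
    rw [hR₁G, hR₂G]
    rcases Bool.or_eq_true_iff.1 hε with h | h
    · exact mem_union_left _ (heΨ ε₁ _ hd₁ h)
    · exact mem_union_right _ (heΨ ε₂ _ hd₂ h)
  -- no other internal monomial touches `p` or `q`
  have untouched : ∀ (ε : Bool) (G : Finset (Fin m)), G ⊆ w₁.2.1 ∪ w₂.2.1 →
      ∀ g' ∈ internalMenu I K (G ∆ (if ε then ({e} : Finset (Fin m)) else ∅)), g' ≠ e →
        (I.vars g' 2 ≠ p ∧ I.vars g' 3 ≠ p) ∧ (I.vars g' 2 ≠ q ∧ I.vars g' 3 ≠ q) := by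
    intro ε G hG g' hg' hne
    obtain ⟨hg'G, h2, h3⟩ := (mem_internalMenu I).1 hg'
    have hg'w : g' ∈ w₁.2.1 ∪ w₂.2.1 := by
      rcases memΨ ε G g' hg'G with h | h
      · exact absurd h hne
      · exact hG h
    have key : ∀ {v : Fin n}, (v = I.vars e 2 ∨ v = I.vars e 3) → I.vars g' 2 ≠ v ∧ I.vars g' 3 ≠ v := by
      intro v hv
      by_contra hne'
      have hgv : I.vars g' 2 = v ∨ I.vars g' 3 = v := by
        by_contra h'; push Not at h'; exact hne' h'
      obtain ⟨z, hGate⟩ := exists_gate_of_slot hO he hg'w hv hgv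
      have hzZ : z ∈ Z := (mem_outside I).2 hGate.2.2
      rcases hGate.2.1 with ⟨-, hz3⟩ | ⟨hz2, -⟩
      · exact h3 (hz3 ▸ hzZ)
      · exact h2 (hz2 ▸ hzZ)
    exact ⟨key (Or.inl rfl), key (Or.inr rfl)⟩
  have hsub₁ : w₁.2.1 ⊆ w₁.2.1 ∪ w₂.2.1 := subset_union_left
  have hsub₂ : w₂.2.1 ⊆ w₁.2.1 ∪ w₂.2.1 := subset_union_right
  refine false_of_free_monomial_of_witness (K := K.erase e) (w₁ := R₁) (w₂ := R₂) (g := e) (y := y) hI hT hS hB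
    ((card_le_card (erase_subset e K)).trans hKr.le) ?_ ?_ ?_ (w := w) ?_ ?_ hg ?_ ?_ ?_ ?_
  · rw [hR₁G]; exact hKΨ ε₁ _ hd₁
  · rw [hR₂G]; exact hKΨ ε₂ _ hd₂
  · -- (T3'') on the fibre
    rintro ⟨z, hz, hz₁, hz₂⟩
    refine T3' ⟨overrideL z L, solves_overrideL_fibreList I hZout w hz, ?_, ?_⟩
    · have h := hz₁
      change gval I (restrictL I Ψ₁.1 Ψ₁.2.1 L).1 (restrictL I Ψ₁.1 Ψ₁.2.1 L).2 z = xor Ψ₁.2.2 (constL I Ψ₁.1 Ψ₁.2.1 L) at h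
      rw [gval_restrictL I hI hS] at h
      revert h; cases gval I Ψ₁.1 Ψ₁.2.1 (overrideL z L) <;> cases Ψ₁.2.2 <;> cases constL I Ψ₁.1 Ψ₁.2.1 L <;> decide
    · have h := hz₂
      change gval I (restrictL I Ψ₂.1 Ψ₂.2.1 L).1 (restrictL I Ψ₂.1 Ψ₂.2.1 L).2 z = xor Ψ₂.2.2 (constL I Ψ₂.1 Ψ₂.2.1 L) at h
      rw [gval_restrictL I hI hS] at h
      revert h; cases gval I Ψ₂.1 Ψ₂.2.1 (overrideL z L) <;> cases Ψ₂.2.2 <;> cases constL I Ψ₂.1 Ψ₂.2.1 L <;> decide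
  · change gval I (restrictL I Ψ₁.1 Ψ₁.2.1 L).1 (restrictL I Ψ₁.1 Ψ₁.2.1 L).2 w = xor Ψ₁.2.2 (constL I Ψ₁.1 Ψ₁.2.1 L)
    rw [gval_restrictL I hI hS, hL, overrideL_fibreList_self, hwΨ₁]
  · change gval I (restrictL I Ψ₂.1 Ψ₂.2.1 L).1 (restrictL I Ψ₂.1 Ψ₂.2.1 L).2 w = xor Ψ₂.2.2 (constL I Ψ₂.1 Ψ₂.2.1 L)
    rw [gval_restrictL I hI hS, hL, overrideL_fibreList_self, hwΨ₂]
  · exact fun j hj => not_mem_varSet_of_private I he (mem_of_mem_erase hj) (ne_of_mem_erase hj) hch.1 (vars_mem_varSet I e 2)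
  · exact fun j hj => not_mem_varSet_of_private I he (mem_of_mem_erase hj) (ne_of_mem_erase hj) hch.2 (vars_mem_varSet I e 3)
  · intro g' hg' hne
    rw [hR₁G, hR₂G] at hg'
    rcases mem_union.1 hg' with h | h
    · exact (untouched ε₁ _ hsub₁ g' h hne).1
    · exact (untouched ε₂ _ hsub₂ g' h hne).1
  · intro g' hg' hne
    rw [hR₁G, hR₂G] at hg'
    rcases mem_union.1 hg' with h | h
    · exact (untouched ε₁ _ hsub₁ g' h hne).2
    · exact (untouched ε₂ _ hsub₂ g' h hne).2

/-- **Packaged: a terminal core has no vertex cut crossed by exactly one member when that member is an outside-gated chord.** -/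
theorem not_unique_crossing (hI : I.IsPure xorAndPred) (hT : Typed I) (hS : SimpleOverlap I) (hB : BoundaryExpanding r I)
    (ht : Terminal I r y K w₁ w₂) (W : Finset (Fin n)) (he : e ∈ K) (hcross : Crosses I W e) (hch : IsChord I K e)
    (hO : OutsideGated I K (w₁.2.1 ∪ w₂.2.1) e) : ∃ f ∈ K, f ≠ e ∧ Crosses I W f := by
  by_contra h
  push Not at h
  exact false_of_clean_bridge hI hT hS hB ht he hch hO hcross h

end Main

end Summit.PneNP.PneNP.Theorems.PstarCleanBridge
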